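import Literature.RingTheory.MvPolynomial.NoetherFormsBertini
import Mathlib.Algebra.MvPolynomial.Nilpotent
import Mathlib.RingTheory.PolynomialAlgebra
import Literature.RingTheory.MvPolynomial.KaltofenNoetherForms
import HarnessLib

/-!
# Proof of Kaltofen's Theorem 7 (`kaltofen1995_thm7_holds`): Lemma 5, Claim B, and the assembly

This file has two parts, each with its own module docstring: PART 1 (Lemma 5 in `F[x, y, z]`,
transport to `F[z][y][x]`, Gauss's lemma for `A[y][x] → Frac(A)[y][x]`, Claim B) directly below;
PART 2 (the Noether forms `Φform`, their degree and norm bounds, the logic of the equivalence over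
`K̄`, and `kaltofen1995_thm7_holds`) starts at the second module docstring.

## Part 1: the generic bivariate image is irreducible
# (Kaltofen's Lemma 5 / Theorem 5 / Lemma 7, existence part) and Claim B

Support file for the proof of Kaltofen's Theorem 7 (`kaltofen1995_thm7`; E. Kaltofen, *Effective
Noether irreducibility forms and applications*, J. Comput. System Sci. 50 (1995) 274–295, §4
Lemma 5, Thm. 5; §5 Lemma 7). Kaltofen's Lemma 5: for good `(ν, ω)`,
`χ(x, y, z₂, …, zₙ) = f(x + ν₁, ω₂x + z₂y + ν₂, …)` is irreducible in `K̄[x, y, z₂, …, zₙ]`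
(proof: a factorization pulls back under `zᵢ ← (Xᵢ - ωᵢ(X₁ - ν₁) - νᵢ)/y`); Theorem 5 then produces
`η` with `χ(x, y, η)` absolutely irreducible by running the algorithm over `K̄(z)`.

Here:

* Lemma 5 in the ring `F[x, y, z]` (`irreducible_chi3`): `χ` is weighted homogeneous for the
  `ℤ`-grading `deg y = -1`, `deg zᵢ = 1`, its factors are homogeneous
  (`IsWeightedHomogeneous.exists_of_mul_left`), and a homogeneous factor whose image under
  `y ↦ 1` is a unit is `c y^k` (`eq_C_mul_X_pow_of_setOne_eq_C`), while `y ∤ χ`;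
* transport to `A_z[y][x]`, `A_z = F[z]`, and Gauss's lemma for the LOCALISATION
  `A_z[y][x] → Frac(A_z)[y][x]` (`irreducible_map_fractionRing`): irreducibility over
  the field `k = F(z)`, in the shape required by Stage I's criterion (S⇒);
* **Claim B** (`exists_point_tauR_ne_zero`): for `f` irreducible of degree `d ≥ 2` over `F = K̄`
  there is a parameter point at which some Stage I form `tauR d (bT d φ_p) t` is non-zero
  (Kaltofen: "there exist `η₂, …, ηₙ ∈ L̄` such that `φ₂` remains irreducible … hence `Φ_t` cannot
  vanish", proof of Lemma 7 / Thm. 7).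

## References

* E. Kaltofen, J. Comput. System Sci. 50 (1995) 274–295, §4 Lemma 5, Thm. 5; §5 Lemma 7.
  [`Kaltofen1995`]
-/

noncomputable section

open Polynomial
open scoped Matrix

namespace Literature.RingTheory.MvPolynomial.NoetherForms

open _root_.MvPolynomial (IsWeightedHomogeneous rename)

/-! ### Setting one variable to `1`: homogeneous polynomials with constant image -/

section SetOne

variable {F : Type*} [Field F] {V : Type*} [DecidableEq V] (y : V)

/-- The substitution `y ↦ 1` (all other variables fixed). [folklore] -/
def setOne : MvPolynomial V F →ₐ[F] MvPolynomial V F :=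
  MvPolynomial.aeval (Function.update MvPolynomial.X y 1)

/-- `y ↦ 1` on monomials: erase the `y`-exponent. [folklore] -/
theorem setOne_monomial (e : V →₀ ℕ) (r : F) :
    setOne y (MvPolynomial.monomial e r) = MvPolynomial.monomial (e.erase y) r := by
  classical
  rw [setOne, MvPolynomial.aeval_monomial, MvPolynomial.algebraMap_eq, ← Finsupp.mul_prod_erase' e y _ (fun i => by simp),
    Function.update_self, one_pow, one_mul, MvPolynomial.monomial_eq]
  congr 1
  rw [Finsupp.prod, Finsupp.prod, Finsupp.support_erase]
  refine Finset.prod_congr rfl fun v hv => ?_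
  rw [Finset.mem_erase] at hv
  rw [Function.update_of_ne hv.1, Finsupp.erase_ne hv.1]

variable {y}

omit [DecidableEq V] in
/-- On the support of a weighted homogeneous polynomial with `w y ≠ 0`, erasing the `y`-exponent is
injective. [folklore] -/
theorem erase_injOn_of_isWeightedHomogeneous {w : V → ℤ} (hwy : w y ≠ 0) {a : MvPolynomial V F} {α : ℤ}
    (ha : IsWeightedHomogeneous w a α) {e e' : V →₀ ℕ} (he : e ∈ a.support) (he' : e' ∈ a.support)
    (h : e.erase y = e'.erase y) : e = e' := by
  have h1 : Finsupp.weight w e = α := ha (MvPolynomial.mem_support_iff.mp he)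
  have h2 : Finsupp.weight w e' = α := ha (MvPolynomial.mem_support_iff.mp he')
  have h3 := congrArg (Finsupp.weight w) (Finsupp.erase_add_single y e)
  have h4 := congrArg (Finsupp.weight w) (Finsupp.erase_add_single y e')
  rw [map_add, h1] at h3
  rw [map_add, h2, ← h] at h4
  have h5 : Finsupp.weight w (Finsupp.single y (e y)) = Finsupp.weight w (Finsupp.single y (e' y)) := by
    linarith
  simp only [Finsupp.weight_apply, Finsupp.sum_single_index, zero_smul] at h5
  rw [nsmul_eq_mul, nsmul_eq_mul] at h5
  have hey : e y = e' y := by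
    have : ((e y : ℤ) - e' y) * w y = 0 := by rw [sub_mul, h5, sub_self]
    rcases mul_eq_zero.mp this with h0 | h0
    · omega
    · exact (hwy h0).elim
  rw [← Finsupp.erase_add_single y e, ← Finsupp.erase_add_single y e', h, hey]

/-- Coefficients of `setOne y a` for `a` weighted homogeneous (`w y ≠ 0`): `[X^{e ∖ y}] a(y=1) = [X^e] a`.
[folklore] -/
theorem coeff_setOne_erase {w : V → ℤ} (hwy : w y ≠ 0) {a : MvPolynomial V F} {α : ℤ}
    (ha : IsWeightedHomogeneous w a α) {e : V →₀ ℕ} (he : e ∈ a.support) :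
    (setOne y a).coeff (e.erase y) = a.coeff e := by
  classical
  conv_lhs => rw [a.as_sum, map_sum]
  simp only [setOne_monomial, MvPolynomial.coeff_sum, MvPolynomial.coeff_monomial]
  rw [Finset.sum_eq_single e]
  · rw [if_pos rfl]
  · intro e' he' hne
    rw [if_neg]
    exact fun h => hne (erase_injOn_of_isWeightedHomogeneous hwy ha he' he h)
  · exact fun h => (h he).elim

/-- **A homogeneous polynomial whose `y ↦ 1` image is a constant is `c · y^k`.** [folklore] -/
theorem eq_C_mul_X_pow_of_setOne_eq_C {w : V → ℤ} (hwy : w y ≠ 0) {a : MvPolynomial V F} {α : ℤ}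
    (ha : IsWeightedHomogeneous w a α) {c : F} (hc : setOne y a = MvPolynomial.C c) :
    ∃ k : ℕ, a = MvPolynomial.C c * MvPolynomial.X y ^ k := by
  classical
  by_cases ha0 : a = 0
  · refine ⟨0, ?_⟩
    have : c = 0 := by
      have h := congrArg (MvPolynomial.coeff 0) hc
      rw [ha0, map_zero, MvPolynomial.coeff_zero, MvPolynomial.coeff_C, if_pos rfl] at h
      exact h.symm
    rw [ha0, this, map_zero, zero_mul]
  -- every exponent in the support is a pure power of `y`
  have hpure : ∀ e ∈ a.support, e.erase y = 0 := by
    intro e he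
    by_contra hne
    have h1 := coeff_setOne_erase hwy ha he
    rw [hc, MvPolynomial.coeff_C, if_neg (Ne.symm hne)] at h1
    exact (MvPolynomial.mem_support_iff.mp he) h1.symm
  -- hence the support is a singleton
  obtain ⟨e₀, he₀⟩ := MvPolynomial.support_nonempty.mpr ha0
  have hsingle : ∀ e ∈ a.support, e = e₀ := fun e he =>
    erase_injOn_of_isWeightedHomogeneous hwy ha he he₀ (by rw [hpure e he, hpure e₀ he₀])
  refine ⟨e₀ y, ?_⟩
  have hc' : a.coeff e₀ = c := by
    have h1 := coeff_setOne_erase hwy ha he₀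
    rw [hc, hpure e₀ he₀, MvPolynomial.coeff_C, if_pos rfl] at h1
    exact h1.symm
  have he₀eq : e₀ = Finsupp.single y (e₀ y) := by
    conv_lhs => rw [← Finsupp.erase_add_single y e₀, hpure e₀ he₀, zero_add]
  calc a = ∑ e ∈ a.support, MvPolynomial.monomial e (a.coeff e) := a.as_sum
    _ = MvPolynomial.monomial e₀ (a.coeff e₀) := by
        rw [Finset.sum_eq_single_of_mem e₀ he₀ fun e he hne => (hne (hsingle e he)).elim]
    _ = MvPolynomial.C c * MvPolynomial.X y ^ e₀ y := by
        rw [hc', MvPolynomial.C_mul_X_pow_eq_monomial, ← he₀eq]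

end SetOne

/-! ### Kaltofen's Lemma 5 in the ring `F[x, y, z]` -/

section Lemma5

variable {F : Type*} [Field F] {m : ℕ} (ν ω : Fin (m + 1) → F)

/-- Variables of `F[x, y, z]`: `none = x`, `some none = y`, `some (some i) = zᵢ` (`z₀` a dummy). [folklore] -/
abbrev V₃ (m : ℕ) := Option (Option (Fin (m + 1)))

/-- The parameter point `(ν, ω, η)`. [folklore] -/
def pF (ν ω η : Fin (m + 1) → F) : PIdx (m + 1) → F :=
  fun kl => if kl.1 = 0 then ν kl.2 else if kl.1 = 1 then ω kl.2 else η kl.2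

/-- The `ℤ`-grading `deg x = 0`, `deg y = -1`, `deg zᵢ = 1` (`i ≥ 1`), `deg z₀ = 0`. [folklore] -/
def w3 (m : ℕ) : V₃ m → ℤ
  | none => 0
  | some none => -1
  | some (some i) => if (i : ℕ) = 0 then 0 else 1

/-- `χ`'s substitution: `X₀ ↦ x + ν₀`, `Xᵢ ↦ ωᵢ x + zᵢ y + νᵢ`. [cite: Kaltofen1995, §4 (before Lemma 4: `χ`)] -/
def θ5 (i : Fin (m + 1)) : MvPolynomial (V₃ m) F :=
  if (i : ℕ) = 0 then MvPolynomial.X none + MvPolynomial.C (ν i)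
  else MvPolynomial.C (ω i) * MvPolynomial.X none +
    MvPolynomial.X (some (some i)) * MvPolynomial.X (some none) + MvPolynomial.C (ν i)

/-- The same at `y = 1`: `X₀ ↦ x + ν₀`, `Xᵢ ↦ ωᵢ x + zᵢ + νᵢ` (an affine change of coordinates).
[cite: Kaltofen1995, Lemma 5 (proof)] -/
def θ1 (i : Fin (m + 1)) : MvPolynomial (V₃ m) F :=
  if (i : ℕ) = 0 then MvPolynomial.X none + MvPolynomial.C (ν i)
  else MvPolynomial.C (ω i) * MvPolynomial.X none + MvPolynomial.X (some (some i)) + MvPolynomial.C (ν i)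

/-- The same at `y = 0`: the univariate translate. [folklore] -/
def θ0 (i : Fin (m + 1)) : MvPolynomial (V₃ m) F :=
  if (i : ℕ) = 0 then MvPolynomial.X none + MvPolynomial.C (ν i)
  else MvPolynomial.C (ω i) * MvPolynomial.X none + MvPolynomial.C (ν i)

/-- The renaming `X₀ ↦ x`, `Xᵢ ↦ zᵢ`. [folklore] -/
def κ3 (i : Fin (m + 1)) : V₃ m := if (i : ℕ) = 0 then none else some (some i)

/-- `κ3` is injective. [folklore] -/
theorem κ3_injective : Function.Injective (κ3 : Fin (m + 1) → V₃ m) := by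
  intro i j h
  unfold κ3 at h
  split_ifs at h with hi hj hj
  · exact Fin.ext (by omega)
  · simpa using h

/-- Forward map of the affine automorphism `x ↦ x + ν₀`, `zᵢ ↦ ωᵢ x + zᵢ + νᵢ`. [cite: Kaltofen1995, Lemma 5 (proof)] -/
def βθ : V₃ m → MvPolynomial (V₃ m) F
  | none => MvPolynomial.X none + MvPolynomial.C (ν 0)
  | some none => MvPolynomial.X (some none)
  | some (some i) => if (i : ℕ) = 0 then MvPolynomial.X (some (some i))
      else MvPolynomial.C (ω i) * MvPolynomial.X none + MvPolynomial.X (some (some i)) + MvPolynomial.C (ν i)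

/-- Its inverse `x ↦ x - ν₀`, `zᵢ ↦ zᵢ - ωᵢ (x - ν₀) - νᵢ`. [cite: Kaltofen1995, Lemma 5 (proof)] -/
def βθ' : V₃ m → MvPolynomial (V₃ m) F
  | none => MvPolynomial.X none - MvPolynomial.C (ν 0)
  | some none => MvPolynomial.X (some none)
  | some (some i) => if (i : ℕ) = 0 then MvPolynomial.X (some (some i))
      else MvPolynomial.X (some (some i)) - MvPolynomial.C (ω i) * (MvPolynomial.X none - MvPolynomial.C (ν 0)) -
        MvPolynomial.C (ν i)

/-- The affine automorphism of `F[x, y, z]`. [cite: Kaltofen1995, Lemma 5 (proof)] -/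
def βEquiv : MvPolynomial (V₃ m) F ≃ₐ[F] MvPolynomial (V₃ m) F :=
  AlgEquiv.ofAlgHom (MvPolynomial.aeval (βθ ν ω)) (MvPolynomial.aeval (βθ' ν ω))
    (by
      refine MvPolynomial.algHom_ext fun v => ?_
      rcases v with _ | _ | i
      · simp [βθ', βθ]
      · simp [βθ', βθ]
      · by_cases hi : (i : ℕ) = 0
        · simp [βθ', βθ, hi]
        · simp only [AlgHom.comp_apply, MvPolynomial.aeval_X, βθ', if_neg hi, map_sub, map_mul,
            MvPolynomial.algHom_C, AlgHom.id_apply, MvPolynomial.algebraMap_eq]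
          simp only [βθ, if_neg hi]
          ring)
    (by
      refine MvPolynomial.algHom_ext fun v => ?_
      rcases v with _ | _ | i
      · simp [βθ', βθ]
      · simp [βθ', βθ]
      · by_cases hi : (i : ℕ) = 0
        · simp [βθ', βθ, hi]
        · simp only [AlgHom.comp_apply, MvPolynomial.aeval_X, βθ, if_neg hi, map_add, map_mul,
            MvPolynomial.algHom_C, AlgHom.id_apply, MvPolynomial.algebraMap_eq]
          simp only [βθ', if_neg hi]
          ring)

/-- The automorphism composed with the renaming is the substitution `θ1`. [folklore] -/
theorem βEquiv_rename (f : MvPolynomial (Fin (m + 1)) F) :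
    βEquiv ν ω (rename κ3 f) = MvPolynomial.aeval (θ1 ν ω) f := by
  rw [βEquiv, AlgEquiv.ofAlgHom_apply, MvPolynomial.aeval_rename,
    show (βθ ν ω ∘ κ3) = θ1 ν ω from funext fun i => ?_]
  unfold κ3 θ1
  by_cases hi : (i : ℕ) = 0
  · have : i = 0 := Fin.ext hi
    subst this
    simp [βθ]
  · rw [Function.comp_apply, if_neg hi, if_neg hi]
    simp only [βθ, if_neg hi]

/-- `f` irreducible ⟹ `χ₁ = f(x + ν₀, ωᵢx + zᵢ + νᵢ)` irreducible. [cite: Kaltofen1995, Lemma 5 (proof)] -/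
theorem irreducible_chi1 {f : MvPolynomial (Fin (m + 1)) F} (hf : Irreducible f) :
    Irreducible (MvPolynomial.aeval (θ1 ν ω) f) := by
  rw [← βEquiv_rename]
  exact (MulEquiv.irreducible_iff (βEquiv ν ω)).mpr (irreducible_rename κ3_injective hf)

/-- Substituting weight-`0` polynomials gives a weight-`0` polynomial. [folklore] -/
theorem isWeightedHomogeneous_aeval_zero {σ τ : Type*} {w : τ → ℤ} {θ : σ → MvPolynomial τ F}
    (hθ : ∀ i, IsWeightedHomogeneous w (θ i) 0) (f : MvPolynomial σ F) :
    IsWeightedHomogeneous w (MvPolynomial.aeval θ f) 0 := by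
  classical
  have h : MvPolynomial.aeval θ f = ∑ e ∈ f.support, MvPolynomial.aeval θ (MvPolynomial.monomial e (f.coeff e)) := by
    conv_lhs => rw [f.as_sum]
    rw [map_sum]
  rw [h]
  refine MvPolynomial.IsWeightedHomogeneous.sum _ _ _ fun e _ => ?_
  rw [MvPolynomial.aeval_monomial, MvPolynomial.algebraMap_eq]
  have hp := MvPolynomial.IsWeightedHomogeneous.prod e.support (fun i => θ i ^ e i) (fun _ => (0 : ℤ))
    (fun i _ => by simpa using (hθ i).pow (e i))
  rw [Finset.sum_const_zero] at hp
  exact hp.C_mul _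

/-- `χ` is homogeneous of weight `0` for the grading `w3`. [folklore] -/
theorem isWeightedHomogeneous_chi3 (f : MvPolynomial (Fin (m + 1)) F) :
    IsWeightedHomogeneous (w3 m) (MvPolynomial.aeval (θ5 ν ω) f) 0 := by
  refine isWeightedHomogeneous_aeval_zero (fun i => ?_) f
  unfold θ5
  split_ifs with hi
  · exact (MvPolynomial.isWeightedHomogeneous_X F (w3 m) none).add (MvPolynomial.isWeightedHomogeneous_C _ _)
  · refine MvPolynomial.IsWeightedHomogeneous.add (MvPolynomial.IsWeightedHomogeneous.add ?_ ?_)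
      (MvPolynomial.isWeightedHomogeneous_C _ _)
    · simpa [w3] using (MvPolynomial.isWeightedHomogeneous_X F (w3 m) none).C_mul (ω i)
    · have := (MvPolynomial.isWeightedHomogeneous_X F (w3 m) (some (some i))).mul
        (MvPolynomial.isWeightedHomogeneous_X F (w3 m) (some none))
      simpa [w3, hi] using this

/-- `y ↦ 1` maps `χ` to `χ₁`. [folklore] -/
theorem setOne_chi3 (f : MvPolynomial (Fin (m + 1)) F) :
    setOne (some none) (MvPolynomial.aeval (θ5 ν ω) f) = MvPolynomial.aeval (θ1 ν ω) f := by
  have hfun : (fun i => setOne (some none : V₃ m) (θ5 ν ω i)) = θ1 ν ω := by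
    funext i
    unfold θ5 θ1 setOne
    by_cases hi : (i : ℕ) = 0
    · rw [if_pos hi, if_pos hi, map_add, MvPolynomial.aeval_X, MvPolynomial.algHom_C, MvPolynomial.algebraMap_eq,
        Function.update_of_ne (by simp)]
    · rw [if_neg hi, if_neg hi, map_add, map_add, map_mul, map_mul, MvPolynomial.aeval_X, MvPolynomial.aeval_X,
        MvPolynomial.aeval_X, MvPolynomial.algHom_C, MvPolynomial.algHom_C, MvPolynomial.algebraMap_eq,
        Function.update_of_ne (by simp), Function.update_of_ne (by simp),
        Function.update_self, mul_one]
  rw [setOne, ← AlgHom.comp_apply, MvPolynomial.comp_aeval, ← setOne, hfun]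

/-- `y ↦ 0` maps `χ` to the univariate translate `χ₀`. [folklore] -/
theorem setZero_chi3 (f : MvPolynomial (Fin (m + 1)) F) :
    MvPolynomial.aeval (Function.update MvPolynomial.X (some none : V₃ m) (0 : MvPolynomial (V₃ m) F))
      (MvPolynomial.aeval (θ5 ν ω) f) = MvPolynomial.aeval (θ0 ν ω) f := by
  have hfun : (fun i => MvPolynomial.aeval (Function.update MvPolynomial.X (some none : V₃ m)
      (0 : MvPolynomial (V₃ m) F)) (θ5 ν ω i)) = θ0 ν ω := by
    funext i
    unfold θ5 θ0
    by_cases hi : (i : ℕ) = 0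
    · rw [if_pos hi, if_pos hi, map_add, MvPolynomial.aeval_X, MvPolynomial.algHom_C, MvPolynomial.algebraMap_eq,
        Function.update_of_ne (by simp)]
    · rw [if_neg hi, if_neg hi, map_add, map_add, map_mul, map_mul, MvPolynomial.aeval_X, MvPolynomial.aeval_X,
        MvPolynomial.aeval_X, MvPolynomial.algHom_C, MvPolynomial.algHom_C, MvPolynomial.algebraMap_eq,
        Function.update_of_ne (by simp), Function.update_of_ne (by simp),
        Function.update_self, mul_zero, add_zero]
  rw [← AlgHom.comp_apply, MvPolynomial.comp_aeval, hfun]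

/-- The map `x ↦ x`, `y, zᵢ ↦ 0` to `F[x]`. [folklore] -/
def ρx : V₃ m → Polynomial F
  | none => Polynomial.X
  | some _ => 0

omit [Field F] in
/-- Row `0` of `pF` is `ν`. [folklore] -/
theorem pF_zero (η : Fin (m + 1) → F) (i : Fin (m + 1)) : pF ν ω η (0, i) = ν i := rfl

omit [Field F] in
/-- Row `1` of `pF` is `ω`. [folklore] -/
theorem pF_one (η : Fin (m + 1) → F) (i : Fin (m + 1)) : pF ν ω η (1, i) = ω i := rfl

/-- `χ₀ ↦ f(x + ν₀, ωᵢ x + νᵢ)` under `x ↦ x`, everything else `↦ 0`. [folklore] -/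
theorem aeval_chi0 (η : Fin (m + 1) → F) (f : MvPolynomial (Fin (m + 1)) F) :
    MvPolynomial.aeval (ρx : V₃ m → Polynomial F) (MvPolynomial.aeval (θ0 ν ω) f) =
      MvPolynomial.aeval (s0 (pF ν ω η)) f := by
  have hfun : (fun i => MvPolynomial.aeval (ρx : V₃ m → Polynomial F) (θ0 ν ω i)) = s0 (pF ν ω η) := by
    funext i
    unfold θ0 s0
    rw [pF_zero, pF_one]
    by_cases hi : (i : ℕ) = 0
    · rw [if_pos hi, if_pos hi, map_add, MvPolynomial.aeval_X, MvPolynomial.algHom_C,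
        Polynomial.algebraMap_eq]
      rfl
    · rw [if_neg hi, if_neg hi, map_add, map_mul, MvPolynomial.aeval_X,
        MvPolynomial.algHom_C, MvPolynomial.algHom_C, Polynomial.algebraMap_eq]
      rfl
  rw [← AlgHom.comp_apply, MvPolynomial.comp_aeval, hfun]

/-- **LEMMA 5 (Kaltofen), in `F[x, y, z]`**: if `f` is irreducible and the univariate translate
`f(x + ν₀, ωᵢx + νᵢ)` is non-zero, then `χ = f(x + ν₀, ωᵢx + zᵢy + νᵢ)` is irreducible in
`F[x, y, z]`. [cite: Kaltofen1995, Lemma 5] -/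
theorem irreducible_chi3 {f : MvPolynomial (Fin (m + 1)) F} (hf : Irreducible f) (η : Fin (m + 1) → F)
    (hP : MvPolynomial.aeval (s0 (pF ν ω η)) f ≠ 0) : Irreducible (MvPolynomial.aeval (θ5 ν ω) f) := by
  have h1 := irreducible_chi1 ν ω hf
  have hhom := isWeightedHomogeneous_chi3 ν ω f
  have hwy : w3 m (some none) ≠ 0 := by simp [w3]
  -- `y ∤ χ`
  have hy : ¬ MvPolynomial.X (some none : V₃ m) ∣ MvPolynomial.aeval (θ5 ν ω) f := by
    rintro ⟨q, hq⟩
    apply hP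
    have h := congrArg (MvPolynomial.aeval (Function.update MvPolynomial.X (some none : V₃ m)
      (0 : MvPolynomial (V₃ m) F))) hq
    rw [setZero_chi3, map_mul, MvPolynomial.aeval_X, Function.update_self, zero_mul] at h
    rw [← aeval_chi0 ν ω η f, h, map_zero]
  -- a homogeneous divisor of `χ` whose `y ↦ 1` image is a unit is a unit
  have key : ∀ (a : MvPolynomial (V₃ m) F) (α : ℤ), IsWeightedHomogeneous (w3 m) a α →
      a ∣ MvPolynomial.aeval (θ5 ν ω) f → IsUnit (setOne (some none) a) → IsUnit a := by
    intro a α ha hdvd hu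
    obtain ⟨c, hc, hac⟩ := MvPolynomial.isUnit_iff_eq_C_of_isReduced.mp hu
    obtain ⟨k, hk⟩ := eq_C_mul_X_pow_of_setOne_eq_C hwy ha hac
    rcases Nat.eq_zero_or_pos k with hk0 | hk0
    · rw [hk, hk0, pow_zero, mul_one]
      exact hc.map MvPolynomial.C
    · exfalso
      apply hy
      have : MvPolynomial.X (some none : V₃ m) ∣ a := by
        obtain ⟨j, rfl⟩ : ∃ j, k = j + 1 := ⟨k - 1, by omega⟩
        exact ⟨MvPolynomial.C c * MvPolynomial.X (some none) ^ j, by rw [hk, pow_succ]; ring⟩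
      exact this.trans hdvd
  refine ⟨fun hu => h1.not_isUnit ?_, fun a b hab => ?_⟩
  · rw [← setOne_chi3]
    exact hu.map _
  · have hne : MvPolynomial.aeval (θ5 ν ω) f ≠ 0 := fun h0 => h1.ne_zero (by rw [← setOne_chi3, h0, map_zero])
    have ha0 : a ≠ 0 := fun h => hne (by rw [hab, h, zero_mul])
    have hb0 : b ≠ 0 := fun h => hne (by rw [hab, h, mul_zero])
    rw [hab] at hhom
    obtain ⟨α, ha⟩ := hhom.exists_of_mul_left hb0
    have hb := hhom.of_mul_right_weight ha ha0
    have hab1 : MvPolynomial.aeval (θ1 ν ω) f = setOne (some none) a * setOne (some none) b := by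
      rw [← setOne_chi3, hab, map_mul]
    rcases h1.isUnit_or_isUnit hab1 with hu | hu
    · exact Or.inl (key a α ha (Dvd.intro b hab.symm) hu)
    · exact Or.inr (key b (0 - α) hb (Dvd.intro_left a hab.symm) hu)

end Lemma5

/-! ### Transport to `A_z[y][x]`, `A_z = F[z]` -/

section Transport

variable {F : Type*} [Field F] {m : ℕ} (ν ω : Fin (m + 1) → F)

/-- The parameter point `(ν, ω, z)` over `A_z = F[z]` (the `η`-row generic). [cite: Kaltofen1995, Thm. 5 (proof)] -/
def pZ : PIdx (m + 1) → MvPolynomial (Fin (m + 1)) F :=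
  fun kl => if kl.1 = 0 then MvPolynomial.C (ν kl.2) else if kl.1 = 1 then MvPolynomial.C (ω kl.2)
    else MvPolynomial.X kl.2

/-- Row `0` of `pZ` is `ν`. [folklore] -/
theorem pZ_zero (i : Fin (m + 1)) : pZ ν ω (0, i) = MvPolynomial.C (ν i) := rfl

/-- Row `1` of `pZ` is `ω`. [folklore] -/
theorem pZ_one (i : Fin (m + 1)) : pZ ν ω (1, i) = MvPolynomial.C (ω i) := rfl

/-- Row `2` of `pZ` is `z`. [folklore] -/
theorem pZ_two (i : Fin (m + 1)) : pZ ν ω (2, i) = MvPolynomial.X i := rfl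

/-- `F[x, y, z] ≃ F[z][y][x]`. [folklore] -/
def Ξ3 : MvPolynomial (V₃ m) F ≃ₐ[F] Polynomial (Polynomial (MvPolynomial (Fin (m + 1)) F)) :=
  (MvPolynomial.optionEquivLeft F (Option (Fin (m + 1)))).trans
    (Polynomial.mapAlgEquiv (MvPolynomial.optionEquivLeft F (Fin (m + 1))))

/-- `Ξ3 x = x`. [folklore] -/
theorem Ξ3_X_none : Ξ3 (MvPolynomial.X (none : V₃ m) : MvPolynomial (V₃ m) F) = Polynomial.X := by
  simp [Ξ3, Polynomial.coe_mapAlgEquiv, MvPolynomial.optionEquivLeft_X_none]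

/-- `Ξ3 y = y`. [folklore] -/
theorem Ξ3_X_some_none :
    Ξ3 (MvPolynomial.X (some none : V₃ m) : MvPolynomial (V₃ m) F) = C Polynomial.X := by
  simp [Ξ3, Polynomial.coe_mapAlgEquiv, MvPolynomial.optionEquivLeft_X_none, MvPolynomial.optionEquivLeft_X_some]

/-- `Ξ3 zᵢ = zᵢ`. [folklore] -/
theorem Ξ3_X_some_some (i : Fin (m + 1)) :
    Ξ3 (MvPolynomial.X (some (some i) : V₃ m) : MvPolynomial (V₃ m) F) = C (C (MvPolynomial.X i)) := by
  simp [Ξ3, Polynomial.coe_mapAlgEquiv, MvPolynomial.optionEquivLeft_X_some]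

/-- `Ξ3` on constants. [folklore] -/
theorem Ξ3_C (c : F) : Ξ3 (MvPolynomial.C c : MvPolynomial (V₃ m) F) = C (C (MvPolynomial.C c)) := by
  simp [Ξ3, Polynomial.coe_mapAlgEquiv, MvPolynomial.optionEquivLeft_C]

/-- `Ξ3` maps the substitution `θ5` to `sT (pZ ν ω)`. [folklore] -/
theorem Ξ3_θ5 (i : Fin (m + 1)) : Ξ3 (θ5 ν ω i) = sT (pZ ν ω) i := by
  unfold θ5 sT
  rw [pZ_zero, pZ_one, pZ_two]
  by_cases hi : (i : ℕ) = 0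
  · rw [if_pos hi, if_pos hi, map_add, Ξ3_X_none, Ξ3_C]
  · rw [if_neg hi, if_neg hi, map_add, map_add, map_mul, map_mul, Ξ3_X_none, Ξ3_C, Ξ3_C, Ξ3_X_some_some,
      Ξ3_X_some_none, ← map_mul]

/-- `Ξ3 χ = φ_{pZ}`. [folklore] -/
theorem Ξ3_chi3 (f : MvPolynomial (Fin (m + 1)) F) :
    Ξ3 (MvPolynomial.aeval (θ5 ν ω) f) = MvPolynomial.aeval (sT (pZ ν ω)) f := by
  have h := MvPolynomial.comp_aeval_apply (B := Polynomial (Polynomial (MvPolynomial (Fin (m + 1)) F)))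
    (f := θ5 ν ω) ((Ξ3 (F := F) (m := m) : MvPolynomial (V₃ m) F ≃ₐ[F] _) : MvPolynomial (V₃ m) F →ₐ[F]
      Polynomial (Polynomial (MvPolynomial (Fin (m + 1)) F))) f
  rw [AlgEquiv.coe_toAlgHom] at h
  rw [h, show (fun i => Ξ3 (θ5 ν ω i)) = sT (pZ ν ω) from funext (Ξ3_θ5 ν ω)]

/-- **LEMMA 5 (Kaltofen), in `F[z][y][x]`**. [cite: Kaltofen1995, Lemma 5] -/
theorem irreducible_aeval_sT_pZ {f : MvPolynomial (Fin (m + 1)) F} (hf : Irreducible f) (η : Fin (m + 1) → F)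
    (hP : MvPolynomial.aeval (s0 (pF ν ω η)) f ≠ 0) : Irreducible (MvPolynomial.aeval (sT (pZ ν ω)) f) := by
  rw [← Ξ3_chi3]
  exact (MulEquiv.irreducible_iff (Ξ3 (F := F) (m := m))).mpr (irreducible_chi3 ν ω hf η hP)

/-- Evaluating `z ↦ η` on `pZ` gives the point `pF ν ω η`. [folklore] -/
theorem eval_comp_pZ (η : Fin (m + 1) → F) :
    (MvPolynomial.eval η : MvPolynomial (Fin (m + 1)) F →+* F) ∘ pZ ν ω = pF ν ω η := by
  funext ⟨k, i⟩
  unfold pZ pF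
  dsimp only [Function.comp_apply]
  split_ifs <;> simp

end Transport

/-! ### Gauss's lemma for `A[y][x] → Frac(A)[y][x]` -/

section Gauss

variable {A k : Type*} [CommRing A] [IsDomain A] [Field k] [Algebra A k] [IsFractionRing A k]

/-- Clearing denominators in `Frac(A)[y][x]`. [folklore] -/
theorem exists_clear_denom (G : k[X][X]) : ∃ a : A, a ≠ 0 ∧ ∃ G' : A[X][X],
    G'.map (mapRingHom (algebraMap A k)) = C (C (algebraMap A k a)) * G := by
  induction G using Polynomial.induction_on' with
  | add p q hp hq =>
    obtain ⟨a, ha, P', hP'⟩ := hp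
    obtain ⟨b, hb, Q', hQ'⟩ := hq
    refine ⟨a * b, mul_ne_zero ha hb, C (C b) * P' + C (C a) * Q', ?_⟩
    rw [Polynomial.map_add, Polynomial.map_mul, Polynomial.map_mul, hP', hQ', Polynomial.map_C, Polynomial.map_C,
      coe_mapRingHom, Polynomial.map_C, Polynomial.map_C, map_mul, map_mul, map_mul]
    ring
  | monomial n g =>
    obtain ⟨b, hbM, hb⟩ := IsLocalization.integerNormalization_spec (nonZeroDivisors A) g
    refine ⟨b, nonZeroDivisors.ne_zero hbM, monomial n (IsLocalization.integerNormalization (nonZeroDivisors A) g),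
      ?_⟩
    rw [Polynomial.map_monomial, coe_mapRingHom, hb, Polynomial.C_mul_monomial, ← algebraMap_smul k b g,
      Polynomial.smul_eq_C_mul]

omit [IsDomain A] in
/-- A polynomial over `A` dividing a non-zero constant becomes a unit over `Frac(A)`. [folklore] -/
theorem isUnit_map_of_dvd_C_C {H : A[X][X]} {c : A} (hc : c ≠ 0) (h : H ∣ C (C c)) :
    IsUnit (H.map (mapRingHom (algebraMap A k))) := by
  refine isUnit_of_dvd_unit (Polynomial.map_dvd _ h) ?_
  rw [Polynomial.map_C, coe_mapRingHom, Polynomial.map_C]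
  exact isUnit_C.mpr (isUnit_C.mpr (Ne.isUnit
    ((map_ne_zero_iff _ (IsFractionRing.injective A k)).mpr hc)))

variable [UniqueFactorizationMonoid A]

/-- **Gauss's lemma for the localisation `A[y][x] → Frac(A)[y][x]`**: an irreducible `P ∈ A[y][x]`
whose image is not a unit stays irreducible. [folklore] -/
theorem irreducible_map_fractionRing {P : A[X][X]} (hP : Irreducible P)
    (hu : ¬ IsUnit (P.map (mapRingHom (algebraMap A k)))) :
    Irreducible (P.map (mapRingHom (algebraMap A k))) := by
  have hinj : Function.Injective (Polynomial.map (mapRingHom (algebraMap A k)) : A[X][X] → k[X][X]) :=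
    Polynomial.map_injective _ (Polynomial.map_injective _ (IsFractionRing.injective A k))
  have hprime : Prime P := UniqueFactorizationMonoid.irreducible_iff_prime.mp hP
  -- one half of the symmetric argument
  have half : ∀ {G' H' : A[X][X]} {c : A}, c ≠ 0 → C (C c) * P = G' * H' → P ∣ G' →
      IsUnit (H'.map (mapRingHom (algebraMap A k))) := by
    intro G' H' c hc hprod hdvd
    obtain ⟨Q, hQ⟩ := hdvd
    refine isUnit_map_of_dvd_C_C hc ⟨Q, ?_⟩
    have h1 : P * (Q * H' - C (C c)) = 0 := by
      rw [mul_sub, ← mul_assoc, ← hQ, ← hprod]; ring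
    rcases mul_eq_zero.mp h1 with h | h
    · exact absurd h hP.ne_zero
    · rw [sub_eq_zero] at h
      rw [← h, mul_comm]
  refine ⟨hu, fun G H hGH => ?_⟩
  obtain ⟨a, ha, G', hG'⟩ := exists_clear_denom (A := A) G
  obtain ⟨b, hb, H', hH'⟩ := exists_clear_denom (A := A) H
  have hprod : C (C (a * b)) * P = G' * H' := hinj (by
    rw [Polynomial.map_mul, Polynomial.map_mul, hG', hH', Polynomial.map_C, coe_mapRingHom, Polynomial.map_C, hGH,
      map_mul, map_mul, map_mul]
    ring)
  have hdvd : P ∣ G' * H' := ⟨_, by rw [← hprod, mul_comm]⟩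
  rcases hprime.dvd_or_dvd hdvd with h | h
  · have hHu := half (mul_ne_zero ha hb) hprod h
    rw [hH'] at hHu
    exact Or.inr (isUnit_of_mul_isUnit_right hHu)
  · have hGu := half (mul_ne_zero ha hb) (by rw [hprod, mul_comm]) h
    rw [hG'] at hGu
    exact Or.inl (isUnit_of_mul_isUnit_right hGu)

end Gauss

/-! ### Claim B: some Stage I form is non-zero at a good parameter point -/

section ClaimB

variable {F : Type*} [Field F] {m d : ℕ}

omit [Field F] in
/-- `TDeg` is preserved by coefficient maps. [folklore] -/
theorem TDeg.map {T T' : Type*} [CommRing T] [CommRing T'] (g : T →+* T') {P : Polynomial (Polynomial T)}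
    {D : ℕ} (hP : TDeg P D) : TDeg (P.map (mapRingHom g)) D := fun i j hij => by
  rw [coeff_map, coe_mapRingHom, coeff_map, hP i j hij, map_zero]

omit [Field F] in
/-- `genF0 d a` only depends on the `y⁰`-column of `a`. [folklore] -/
theorem genF0_congr0 {R : Type*} [CommRing R] {a a' : Idx d → R} (h : ∀ i : Fin d, a (i, 0) = a' (i, 0)) :
    genF0 d a = genF0 d a' := by
  unfold genF0
  simp only [h]

/-- The `xⁱy⁰`-coefficient of `φ_p` is the `xⁱ`-coefficient of the univariate translate. [folklore] -/
theorem coeff_coeff_zero_eq {T : Type*} [CommRing T] [Algebra F T] (p : PIdx (m + 1) → T)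
    (f : MvPolynomial (Fin (m + 1)) F) (i : ℕ) :
    ((MvPolynomial.aeval (sT p) f).coeff i).coeff 0 = (MvPolynomial.aeval (s0 p) f).coeff i := by
  rw [← map_evalRingHom_zero_aeval_sT, coeff_map, coe_evalRingHom, coeff_zero_eq_eval_zero]

/-- **CLAIM B** (Kaltofen, proof of Lemma 7 / Theorem 7: "there exist `η₂, …, ηₙ` such that `φ₂`
remains irreducible … hence `Φ_t` cannot vanish"): for `f` irreducible of total degree `d ≥ 2` over an
algebraically closed field there are a parameter point `p` and an index `t` with
`tauR d (bT d φ_p) t ≠ 0`. Proof: Lemma 4 gives `(ν, ω)` with `λ ≠ 0` and `f_p(x, 0)` separable;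
Lemma 5 + Gauss give the irreducibility of `φ` over `k = F(z)`; Stage I's criterion (S⇒) over `k`
gives a non-vanishing `Σ_ι τ_{S,ι} ζ₀^ι`, an element of `F[z]`, which is then specialised at a good
`η`. [cite: Kaltofen1995, Lemma 7 (proof) & Thm. 5] -/
theorem exists_point_tauR_ne_zero [IsAlgClosed F] {f : MvPolynomial (Fin (m + 1)) F} (hf : Irreducible f)
    (hfd : f.totalDegree = d) (hd : 2 ≤ d) :
    ∃ p : PIdx (m + 1) → F, ∃ t : TIdx d, tauR d (bT d (MvPolynomial.aeval (sT p) f)) t ≠ 0 := by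
  have hd0 : 0 < d := by omega
  obtain ⟨p₁, hlam, hsep⟩ := exists_point_separable hf hfd hd0
  have hp₁ : pF (fun i => p₁ (0, i)) (fun i => p₁ (1, i)) (fun i => p₁ (2, i)) = p₁ := by
    funext ⟨k, i⟩
    unfold pF
    dsimp only
    fin_cases k <;> simp
  -- the generic-`η` point over `A = F[z]`
  set pz : PIdx (m + 1) → MvPolynomial (Fin (m + 1)) F := pZ (fun i => p₁ (0, i)) (fun i => p₁ (1, i)) with hpz
  set φZ : Polynomial (Polynomial (MvPolynomial (Fin (m + 1)) F)) := MvPolynomial.aeval (sT pz) f with hφZ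
  set φ₁ : Polynomial (Polynomial F) := MvPolynomial.aeval (sT p₁) f with hφ₁
  -- specialisations `z ↦ η`
  have hZη : ∀ η : Fin (m + 1) → F, φZ.map (mapRingHom (MvPolynomial.eval η)) =
      MvPolynomial.aeval (sT (pF (fun i => p₁ (0, i)) (fun i => p₁ (1, i)) η)) f := fun η => by
    rw [hφZ, map_map_aeval_sT' _ (by ext c; simp) pz f, hpz, eval_comp_pZ]
  -- `y ↦ 0`: `φ_Z(x, 0) = φ₁(x, 0)`
  have h0 : MvPolynomial.aeval (s0 pz) f =
      (MvPolynomial.aeval (s0 p₁) f).map (algebraMap F (MvPolynomial (Fin (m + 1)) F)) := by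
    have hofId : ((Algebra.ofId F (MvPolynomial (Fin (m + 1)) F) : F →ₐ[F] MvPolynomial (Fin (m + 1)) F) :
        F →+* MvPolynomial (Fin (m + 1)) F) = algebraMap F (MvPolynomial (Fin (m + 1)) F) := rfl
    rw [← hofId, map_aeval_s0, hofId, show s0 pz = s0 ((algebraMap F (MvPolynomial (Fin (m + 1)) F)) ∘ p₁) from
      funext fun i => by
        unfold s0
        rw [hpz, pZ_zero, pZ_one]
        simp [Function.comp_apply, MvPolynomial.algebraMap_eq]]
  -- the univariate translate is non-zero (`λ ≠ 0`), so Lemma 5 applies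
  have hP0 : MvPolynomial.aeval (s0 (pF (fun i => p₁ (0, i)) (fun i => p₁ (1, i)) (fun i => p₁ (2, i)))) f ≠ 0 := by
    rw [hp₁]
    intro h
    apply hlam
    rw [coeff_coeff_zero_eq, h, coeff_zero]
  have hirrZ : Irreducible φZ := irreducible_aeval_sT_pZ _ _ hf _ hP0
  have hlamZ : (φZ.coeff d).coeff 0 ≠ 0 := by
    intro h
    apply hlam
    have h2 := congrArg (fun P : Polynomial (Polynomial F) => (P.coeff d).coeff 0) (hZη fun i => p₁ (2, i))
    simp only [coeff_map, coe_mapRingHom] at h2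
    rw [hp₁] at h2
    rw [← h2, h, map_zero]
  -- over `k = Frac(A)`
  set ι : MvPolynomial (Fin (m + 1)) F →+* FractionRing (MvPolynomial (Fin (m + 1)) F) := algebraMap _ _ with hι
  have hιinj : Function.Injective ι := IsFractionRing.injective _ _
  set φk := φZ.map (mapRingHom ι) with hφk
  have hlamk : (φk.coeff d).coeff 0 ≠ 0 := by
    rw [hφk, coeff_map, coe_mapRingHom, coeff_map]
    exact (map_ne_zero_iff ι hιinj).mpr hlamZ
  have hTZ' : TDeg φZ d := by
    have h := TDeg_aeval_sT (p := pz) f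
    rwa [hfd] at h
  have hTk : TDeg φk d := hTZ'.map ι
  have hku : ¬ IsUnit φk := fun hu => by
    have h0' := Polynomial.natDegree_eq_zero_of_isUnit hu
    have hc : φk.coeff d ≠ 0 := fun h => hlamk (by rw [h, coeff_zero])
    have := Polynomial.le_natDegree_of_ne_zero hc
    omega
  have hirrk : Irreducible φk := irreducible_map_fractionRing hirrZ hku
  have hpsi : Irreducible (psi d (bT d φk)) := (irreducible_psi_bT_iff hd0 hTk hlamk).mpr hirrk
  -- `genF0 (bT φ_k)` is `genF0 (bT φ₁)` with coefficients mapped into `k`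
  have hc0 : ∀ n : ℕ, (φk.coeff n).coeff 0 =
      ι (algebraMap F (MvPolynomial (Fin (m + 1)) F) ((φ₁.coeff n).coeff 0)) := by
    intro n
    rw [hφk, coeff_map, coe_mapRingHom, coeff_map, hφZ, coeff_coeff_zero_eq, h0, coeff_map, hφ₁,
      coeff_coeff_zero_eq]
  have hbT0 : ∀ i : Fin d, bT d φk (i, 0) =
      (ι.comp (algebraMap F (MvPolynomial (Fin (m + 1)) F))) (bT d φ₁ (i, 0)) := by
    intro i
    simp only [bT, RingHom.comp_apply, map_mul, map_pow, Fin.val_zero]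
    rw [hc0, hc0]
  have hgen : genF0 d (bT d φk) =
      ((genF0 d (bT d φ₁)).map (algebraMap F (MvPolynomial (Fin (m + 1)) F))).map ι := by
    rw [Polynomial.map_map, map_genF0]
    exact genF0_congr0 hbT0
  -- a (simple) root of `genF0 (bT φ₁)` in `F`
  obtain ⟨ζ₀, hζ₀⟩ := IsAlgClosed.exists_root (genF0 d (bT d φ₁)) (by
    rw [Polynomial.degree_eq_natDegree (monic_genF0 d _).ne_zero, natDegree_genF0]
    exact_mod_cast hd0.ne')
  have hινinj : Function.Injective (ι.comp (algebraMap F (MvPolynomial (Fin (m + 1)) F))) := by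
    rw [RingHom.coe_comp]
    exact hιinj.comp (algebraMap F (MvPolynomial (Fin (m + 1)) F)).injective
  set ζk := (ι.comp (algebraMap F (MvPolynomial (Fin (m + 1)) F))) ζ₀ with hζk
  have hroot : (genF0 d (bT d φk)).eval ζk = 0 := by
    rw [hgen, Polynomial.map_map, eval_map, hζk, eval₂_at_apply]
    rw [show (genF0 d (bT d φ₁)).eval ζ₀ = 0 from hζ₀, map_zero]
  have hδ : δ0 d (bT d φk) ζk ≠ 0 := by
    unfold δ0 deltaHat
    rw [hgen, Polynomial.map_map, Polynomial.derivative_map, eval_map, hζk, eval₂_at_apply]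
    refine (map_ne_zero_iff _ hινinj).mpr ?_
    have h := hsep.aeval_derivative_ne_zero (x := ζ₀) (by rw [Polynomial.coe_aeval_eq_eval]; exact hζ₀)
    rwa [Polynomial.coe_aeval_eq_eval] at h
  -- Stage I criterion (S⇒) over `k`
  obtain ⟨S, hS⟩ := exists_minor_ne_zero_of_irreducible d hd hroot hδ hpsi
  -- pull the sum back to `A = F[z]`
  set TZ : MvPolynomial (Fin (m + 1)) F := ∑ i : Fin d, tauR d (bT d φZ) (S, i) *
    (algebraMap F (MvPolynomial (Fin (m + 1)) F) ζ₀) ^ (i : ℕ) with hTZ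
  have hsum : (∑ i : Fin d, tauR d (bT d φk) (S, i) * ζk ^ (i : ℕ)) = ι TZ := by
    rw [hTZ, map_sum]
    refine Finset.sum_congr rfl fun i _ => ?_
    rw [map_mul, map_pow, map_tauR, hφk, bT_map, hζk, RingHom.comp_apply]
  have hTZ0 : TZ ≠ 0 := fun h => hS (by rw [hsum, h, map_zero])
  -- specialise at a good `η`
  obtain ⟨η, hη⟩ : ∃ η : Fin (m + 1) → F, MvPolynomial.eval η TZ ≠ 0 := by
    by_contra hall
    push Not at hall
    exact hTZ0 (MvPolynomial.funext fun x => by rw [hall x, map_zero])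
  have hev : MvPolynomial.eval η TZ = ∑ i : Fin d,
      tauR d (bT d (MvPolynomial.aeval (sT (pF (fun i => p₁ (0, i)) (fun i => p₁ (1, i)) η)) f)) (S, i) *
        ζ₀ ^ (i : ℕ) := by
    rw [hTZ, map_sum]
    refine Finset.sum_congr rfl fun i _ => ?_
    rw [map_mul, map_pow, map_tauR (ψ' := MvPolynomial.eval η), ← bT_map, hZη η, MvPolynomial.algebraMap_eq,
      MvPolynomial.eval_C]
  rw [hev] at hη
  obtain ⟨i, -, hi⟩ := Finset.exists_ne_zero_of_sum_ne_zero hη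
  exact ⟨_, (S, i), left_ne_zero_of_mul hi⟩

end ClaimB

end Literature.RingTheory.MvPolynomial.NoetherForms

/-!
# Proof of Kaltofen's Theorem 7 (effective Noether irreducibility forms)

`kaltofen1995_thm7_holds : kaltofen1995_thm7` (E. Kaltofen, *Effective Noether irreducibility forms
and applications*, J. Comput. System Sci. 50 (1995) 274–295, Thm. 7).

The forms. For `t = (e, m₁, m₂, t')` the form is
`Φ_t = c_e · [p^{m₁}] P̄ · [p^{m₂}] τ_{t'}` where `c_e` is a coefficient variable, `P̄ ∈ ℤ[p, c]` the
generic resultant `Res_x(ψ₀, ψ₀')` of the rescaled generic substituted polynomial at `y = 0`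
(`Pbar`, Kaltofen's `ρ̄` up to the rescaling `x ← x/λ` that removes his division by `ldcf_x`),
`τ_{t'} ∈ ℤ[p, c]` the Stage I forms (`tauR`, the coefficients of the reductions modulo `ψ₀(z)` of the
maximal minors of the linear system "`ψ = g h` with `g` a truncated power series factor through
the generic root", Kaltofen's Thm. 4 / Step N–L), and `[p^m]` extracts the coefficient of the
parameter monomial `p^m` (`pcoeff`; Kaltofen: "the coefficients in `v, w, z` of `ρ₂ ρ̄₂^{2k-1} Φ_t`
are the Noether forms").

The proof of the equivalence, for `f` of formal degree `d` over `K` (everything is checked over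
`F = K̄`, `IsAbsIrreducible f ↔ Irreducible f_F`):

* (⇐) if `deg f < d` or `f_F` is reducible then at every parameter point `p` either the resultant
  vanishes or `ψ₀` is separable and `ψ = psi d (bT φ_p)` splits into monic factors of positive
  degree (`exists_monic_split`), whence every `τ_{t'}(p) = 0` by Stage I (S⇐)
  (`minors_vanish_of_mul`) at the `d` simple roots of `ψ₀` (`tauR_eq_zero_of_split`); so the
  polynomial `p ↦ P̄(p) τ_{t'}(p)` vanishes identically, hence one factor does, hence all its
  `p`-coefficients do (`aeval_pcoeff_mul_eq_zero`);
* (⇒) if `deg f = d` and `f_F` is irreducible then some `c_e ≠ 0`, `P̄(p₁) ≠ 0` for the point of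
  Lemma 4 (`exists_point_separable`) and `τ_{t'}(p₂) ≠ 0` for the point of Claim B
  (`exists_point_tauR_ne_zero`), so some `[p^{m₁}] P̄`, `[p^{m₂}] τ_{t'}` are non-zero at the
  coefficients of `f` and the form `Φ_{(e, m₁, m₂, t')}` does not vanish.

The bounds `deg Φ_t ≤ 12 d⁶`, `‖Φ_t‖₁ ≤ (2d)^{12d⁷ + 12d⁶n + 32d⁶}` follow from the isobaric weights
(`isWeightedHomogeneous_Pbar`, `isWeightedHomogeneous_tauR_bgen`) and the norm estimates
(`l1Norm_Pbar_le`, `l1Norm_tauR_bgen_le`) by elementary arithmetic (`normExp_le`).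

## References

* E. Kaltofen, J. Comput. System Sci. 50 (1995) 274–295, Thm. 7 (and Thm. 4, Lemmas 4, 5, 7).
  [`Kaltofen1995`]
-/

noncomputable section

open Polynomial

namespace Literature.RingTheory.MvPolynomial

namespace NoetherForms

open _root_.MvPolynomial (IsWeightedHomogeneous)

/-! ### The forms -/

section Forms

variable (n d : ℕ)

/-- The parameter monomials of `P̄`. [folklore] -/
def M₁ : Finset (PIdx n →₀ ℕ) := (Pbar n d).support.image lpart

/-- The parameter monomials of the `τ`-forms. [folklore] -/
def M₂ : Finset (PIdx n →₀ ℕ) :=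
  Finset.univ.biUnion fun t : TIdx d => (tauR d (bgen n d) t).support.image lpart

/-- The index set of the Noether forms. [cite: Kaltofen1995, Thm. 7 ("`∃ t`")] -/
abbrev KIdx := (Sd n d) × (M₁ n d) × (M₂ n d) × TIdx d

/-- **The Noether forms** `Φ_t = c_e · [p^{m₁}] P̄ · [p^{m₂}] τ_{t'}`. [cite: Kaltofen1995, Thm. 7 (proof)] -/
def Φform (t : KIdx n d) : MvPolynomial (CIdx n) ℤ :=
  MvPolynomial.X (t.1 : CIdx n) * pcoeff (t.2.1 : PIdx n →₀ ℕ) (Pbar n d) *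
    pcoeff (t.2.2.1 : PIdx n →₀ ℕ) (tauR d (bgen n d) t.2.2.2)

end Forms

/-! ### The τ-forms of negative weight vanish -/

section Weight

variable (n d : ℕ)

/-- A `wt`-homogeneous integer form of negative weight is zero (all weights are `≥ 0`). [folklore] -/
theorem tauR_aX_eq_zero_of_neg (t : TIdx d) (h : minorWeight d t.1 - (t.2 : ℕ) < 0) : tauR d (aX d) t = 0 := by
  by_contra hne
  obtain ⟨mono, hm⟩ := MvPolynomial.ne_zero_iff.mp hne
  have hw : (Finsupp.weight (wt d) mono : ℤ) = minorWeight d t.1 - (t.2 : ℕ) := isWeightedHomogeneous_tauR d t hm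
  have hnn : 0 ≤ (Finsupp.weight (wt d) mono : ℤ) := by
    rw [Finsupp.weight_apply, Finsupp.sum]
    refine Finset.sum_nonneg fun ij _ => ?_
    rw [wt_eq_natCast, nsmul_eq_mul]
    positivity
  omega

/-- Hence the corresponding `τ`-form is zero. [folklore] -/
theorem tauR_bgen_eq_zero_of_neg (t : TIdx d) (h : minorWeight d t.1 - (t.2 : ℕ) < 0) :
    tauR d (bgen n d) t = 0 := by
  rw [tauR_bgen_eq, tauR_aX_eq_zero_of_neg d t h, map_zero]

end Weight

/-! ### Degree and norm of the forms: arithmetic -/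

section Arith

variable (n d : ℕ)

/-- `|S_d| ≤ (d + 1)ⁿ`. [folklore] -/
theorem card_Sd_le : (Sd n d).card ≤ (d + 1) ^ n := by
  classical
  let g : CIdx n → (Fin n → Fin (d + 1)) := fun e i => ⟨min (e i) d, by omega⟩
  have hinj : Set.InjOn g (Sd n d : Set (CIdx n)) := by
    intro e he e' he' h
    rw [Finset.mem_coe, mem_Sd] at he he'
    ext i
    have h1 : e i ≤ d := (Finsupp.le_degree i e).trans he
    have h2 : e' i ≤ d := (Finsupp.le_degree i e').trans he'
    have h3 := congrArg (fun v : Fin n → Fin (d + 1) => ((v i : Fin (d + 1)) : ℕ)) h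
    simp only [g] at h3
    omega
  calc (Sd n d).card ≤ (Finset.univ : Finset (Fin n → Fin (d + 1))).card :=
        Finset.card_le_card_of_injOn g (fun _ _ => Finset.mem_coe.mpr (Finset.mem_univ _)) hinj
    _ = (d + 1) ^ n := by simp

variable {d}

/-- `A₀ ≤ (2d)^{n+d}` for `d ≥ 2`. [folklore] -/
theorem A₀_le (hd : 2 ≤ d) : A₀ n d ≤ (2 * d) ^ (n + d) := by
  unfold A₀
  rw [pow_add]
  exact Nat.mul_le_mul ((card_Sd_le n d).trans (Nat.pow_le_pow_left (by omega) n))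
    (Nat.pow_le_pow_left (by omega) d)

/-- The norm bound of `P̄` as a power of `2d`. [folklore] -/
theorem normPbar_le (hd : 2 ≤ d) :
    (d + d).factorial * (((d + 1) * A₀ n d ^ d) ^ d * (A₀ n d ^ d) ^ d) ≤
      (2 * d) ^ (2 * d + d + (n + d) * (2 * d * d)) := by
  have hA := A₀_le n hd
  rw [pow_add, pow_add, mul_assoc]
  refine Nat.mul_le_mul ?_ ?_
  · rw [← two_mul]
    exact Nat.factorial_le_pow _
  · rw [mul_pow, mul_assoc, ← pow_mul, ← pow_add, show d * d + d * d = 2 * d * d by ring]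
    refine Nat.mul_le_mul (Nat.pow_le_pow_left (by omega) d) ((Nat.pow_le_pow_left hA _).trans_eq ?_)
    rw [← pow_mul]

/-- `Tc ≤ (2d)^{2 Dz + 3d + 6}`. [folklore] -/
theorem Tc_le (hd : 2 ≤ d) : Tc d ≤ (2 * d) ^ (2 * Dz d + 3 * d + 6) := by
  have h2 : 2 ≤ 2 * d := by omega
  have hcR : cR d ≤ (2 * d) ^ Dz d := Nat.pow_le_pow_left (by omega) _
  have h2d : 2 ^ d ≤ (2 * d) ^ d := Nat.pow_le_pow_left h2 d
  have hd1 : d + 1 ≤ 2 * d := by omega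
  have hcδ : cδ d ≤ (2 * d) ^ (d + 1) := by
    unfold cδ; rw [pow_succ]; exact Nat.mul_le_mul h2d hd1
  have hcQ : cQ d ≤ (2 * d) ^ (d + 2) := by
    unfold cQ
    calc (d + 1) * cδ d ≤ (2 * d) * (2 * d) ^ (d + 1) := Nat.mul_le_mul hd1 hcδ
      _ = (2 * d) ^ (d + 2) := by ring
  have hcG : cG d ≤ (2 * d) ^ (d + 2) := by
    unfold cG
    calc d * d * 2 ^ d ≤ (2 * d) * (2 * d) * (2 * d) ^ d :=
          Nat.mul_le_mul (Nat.mul_le_mul (by omega) (by omega)) h2d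
      _ = (2 * d) ^ (d + 2) := by ring
  unfold Tc
  calc 4 * cR d ^ 2 * cQ d * cδ d * cG d
      ≤ (2 * d) * ((2 * d) ^ Dz d) ^ 2 * (2 * d) ^ (d + 2) * (2 * d) ^ (d + 1) * (2 * d) ^ (d + 2) := by
        gcongr
        omega
    _ = (2 * d) ^ (2 * Dz d + 3 * d + 6) := by ring

/-- `Ent ≤ (2d)^{Dz + d + ℓ (2 Dz + 3d + 6)}`. [folklore] -/
theorem Ent_le (hd : 2 ≤ d) : Ent d ≤ (2 * d) ^ (Dz d + d + ℓ d * (2 * Dz d + 3 * d + 6)) := by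
  unfold Ent
  rw [pow_add, pow_add, pow_mul']
  refine Nat.mul_le_mul (Nat.mul_le_mul (Nat.pow_le_pow_left (by omega) _) (Nat.pow_le_pow_left (by omega) _)) ?_
  exact Nat.pow_le_pow_left (Tc_le hd) _

/-- The exponent of `Ent`. [folklore] -/
def eEnt (d : ℕ) : ℕ := Dz d + d + ℓ d * (2 * Dz d + 3 * d + 6)

/-- `Bτ ≤ (2d)^{Nu (d-1) + 2 Nu + Nu · eEnt}`. [folklore] -/
theorem Bτ_le (hd : 2 ≤ d) : Bτ d ≤ (2 * d) ^ (Nu d * (d - 1) + 2 * Nu d + Nu d * eEnt d) := by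
  unfold Bτ
  rw [pow_add, pow_add]
  refine Nat.mul_le_mul (Nat.mul_le_mul (Nat.pow_le_pow_left (by omega) _) ?_) ?_
  · calc (Nu d).factorial ≤ Nu d ^ Nu d := Nat.factorial_le_pow _
      _ ≤ ((2 * d) ^ 2) ^ Nu d := Nat.pow_le_pow_left (by unfold Nu; nlinarith) _
      _ = (2 * d) ^ (2 * Nu d) := by rw [← pow_mul]
  · rw [pow_mul']
    exact Nat.pow_le_pow_left (Ent_le hd) _

/-- The final exponent inequality for the norm. [folklore] -/
theorem normExp_le (hd : 2 ≤ d) (n : ℕ) :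
    (2 * d + d + (n + d) * (2 * d * d)) + (Nu d * (d - 1) + 2 * Nu d + Nu d * eEnt d) + (n + d) * Wτ d ≤
      12 * d ^ 7 + 12 * d ^ 6 * n + 32 * d ^ 6 := by
  obtain ⟨k, rfl⟩ : ∃ k, d = k + 2 := ⟨d - 2, by omega⟩
  unfold Nu eEnt Wτ ℓ Dz
  rw [show k + 2 - 1 = k + 1 from rfl]
  ring_nf
  omega

/-- The final exponent inequality for the degree. [folklore] -/
theorem degExp_le (hd : 2 ≤ d) : 1 + d * (d - 1) + Wτ d ≤ 12 * d ^ 6 := by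
  obtain ⟨k, rfl⟩ : ∃ k, d = k + 2 := ⟨d - 2, by omega⟩
  unfold Wτ ℓ
  rw [show k + 2 - 1 = k + 1 from rfl]
  ring_nf
  omega

end Arith

/-! ### Degree and norm of the forms -/

section Bounds

variable (n : ℕ) {d : ℕ}

/-- The weight of a `τ`-form as a natural number. [folklore] -/
theorem tauR_weight_cases (t : TIdx d) :
    (∃ W' : ℕ, ((W' : ℤ) = minorWeight d t.1 - (t.2 : ℕ)) ∧ W' ≤ Wτ d) ∨ tauR d (bgen n d) t = 0 := by
  by_cases h : 0 ≤ minorWeight d t.1 - (t.2 : ℕ)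
  · refine Or.inl ⟨(minorWeight d t.1 - (t.2 : ℕ)).toNat, Int.toNat_of_nonneg h, ?_⟩
    have := minorWeight_le d t.1
    omega
  · exact Or.inr (tauR_bgen_eq_zero_of_neg n d t (by omega))

/-- **Degree of the forms**: `deg Φ_t ≤ 12 d⁶`. [cite: Kaltofen1995, Thm. 7] -/
theorem totalDegree_Φform_le (hd : 2 ≤ d) (t : KIdx n d) : (Φform n d t).totalDegree ≤ 12 * d ^ 6 := by
  have hd0 : 0 < d := by omega
  refine le_trans ?_ (degExp_le hd)
  rw [Φform]
  refine (MvPolynomial.totalDegree_mul _ _).trans (Nat.add_le_add ((MvPolynomial.totalDegree_mul _ _).trans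
    (Nat.add_le_add (MvPolynomial.totalDegree_X _).le ?_)) ?_)
  · have h := isWeightedHomogeneous_pcoeff (w := fun _ => (1 : ℕ)) (isWeightedHomogeneous_Pbar n d hd0)
      (t.2.1 : PIdx n →₀ ℕ)
    exact MvPolynomial.IsHomogeneous.totalDegree_le h
  · rcases tauR_weight_cases n t.2.2.2 with ⟨W', hW', hle⟩ | h0
    · have h := isWeightedHomogeneous_pcoeff (w := fun _ => (1 : ℕ)) (isWeightedHomogeneous_tauR_bgen n d _ hW')
        (t.2.2.1 : PIdx n →₀ ℕ)
      exact (MvPolynomial.IsHomogeneous.totalDegree_le h).trans hle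
    · rw [h0, pcoeff_zero, MvPolynomial.totalDegree_zero]
      exact Nat.zero_le _

/-- **Norm of the forms**: `‖Φ_t‖₁ ≤ (2d)^{12d⁷ + 12d⁶n + 32d⁶}`. [cite: Kaltofen1995, Thm. 7] -/
theorem l1Norm_Φform_le (hd : 2 ≤ d) (t : KIdx n d) :
    l1Norm (Φform n d t) ≤ (2 * d) ^ (12 * d ^ 7 + 12 * d ^ 6 * n + 32 * d ^ 6) := by
  have hd0 : 0 < d := by omega
  have h1 : 1 ≤ 2 * d := by omega
  refine le_trans ?_ (Nat.pow_le_pow_right h1 (normExp_le hd n))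
  rw [pow_add, pow_add, mul_assoc, Φform]
  refine (l1Norm_mul_le _ _).trans ?_
  refine Nat.mul_le_mul ((l1Norm_mul_le _ _).trans ?_) ?_
  · rw [l1Norm_X, one_mul]
    exact ((l1Norm_pcoeff_le _ _).trans (l1Norm_Pbar_le n d)).trans (normPbar_le n hd)
  · refine (l1Norm_pcoeff_le _ _).trans ?_
    rcases tauR_weight_cases n t.2.2.2 with ⟨W', hW', hle⟩ | h0
    · refine (l1Norm_tauR_bgen_le n d hd0 _ hW').trans ?_
      rw [pow_mul]
      refine Nat.mul_le_mul (Bτ_le hd) ?_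
      exact (Nat.pow_le_pow_right (one_le_A₀ n d) hle).trans (Nat.pow_le_pow_left (A₀_le n hd) _)
    · rw [h0, l1Norm_zero]
      exact Nat.zero_le _

end Bounds

/-! ### The logic of the forms over an algebraically closed field -/

section Logic

variable {F : Type*} [Field F] {n d : ℕ}

omit [Field F] in
/-- A reducible monic polynomial of positive degree over a domain splits into two monic factors of
positive degree. [folklore] -/
theorem exists_monic_split {S : Type*} [CommRing S] [IsDomain S] {P : S[X]} (hP : P.Monic)
    (hirr : ¬ Irreducible P) (hdeg : 0 < P.natDegree) :
    ∃ g h : S[X], g.Monic ∧ h.Monic ∧ 0 < g.natDegree ∧ 0 < h.natDegree ∧ P = g * h := by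
  have hPu : ¬ IsUnit P := fun hu => by
    rw [hP.isUnit_iff] at hu
    rw [hu, natDegree_one] at hdeg
    exact lt_irrefl _ hdeg
  obtain ⟨g', h', hgh, hg', hh'⟩ : ∃ g' h', P = g' * h' ∧ ¬ IsUnit g' ∧ ¬ IsUnit h' := by
    by_contra hcon
    push Not at hcon
    exact hirr ⟨hPu, fun a b hab => or_iff_not_imp_left.mpr (hcon a b hab)⟩
  have hlc : g'.leadingCoeff * h'.leadingCoeff = 1 := by
    rw [← leadingCoeff_mul, ← hgh]
    exact hP
  have hgm : (g' * C h'.leadingCoeff).Monic := by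
    rw [Monic, leadingCoeff_mul, leadingCoeff_C, hlc]
  have hhm : (h' * C g'.leadingCoeff).Monic := by
    rw [Monic, leadingCoeff_mul, leadingCoeff_C, mul_comm, hlc]
  refine ⟨g' * C h'.leadingCoeff, h' * C g'.leadingCoeff, hgm, hhm, ?_, ?_, ?_⟩
  · refine Nat.pos_of_ne_zero fun h0 => hg' ?_
    rw [hgm.natDegree_eq_zero] at h0
    exact IsUnit.of_mul_eq_one _ h0
  · refine Nat.pos_of_ne_zero fun h0 => hh' ?_
    rw [hhm.natDegree_eq_zero] at h0
    exact IsUnit.of_mul_eq_one _ h0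
  · rw [mul_mul_mul_comm, ← C_mul, mul_comm h'.leadingCoeff, hlc, C_1, mul_one]
    exact hgh

/-- **(S⇐) at all simple roots**: if `ψ₀ = genF0 d b` is separable and `ψ = psi d b` splits into monic
factors of positive degree then every `τ`-form vanishes at `b` (Vandermonde at the `d` simple roots:
`exists_root_eval_ne_zero`). [cite: Kaltofen1995, Thm. 4 & Lemma 7 (proof, "⇐")] -/
theorem tauR_eq_zero_of_split [IsAlgClosed F] {b : Idx d → F} (hd0 : 0 < d) (hsep : (genF0 d b).Separable)
    {g h : Polynomial (Polynomial F)} (hg : g.Monic) (hh : h.Monic) (hgpos : 0 < g.natDegree)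
    (hhpos : 0 < h.natDegree) (hψ : psi d b = g * h) (t : TIdx d) : tauR d b t = 0 := by
  obtain ⟨S, ι⟩ := t
  set R : F[X] := ∑ i : Fin d, C (tauR d b (S, i)) * X ^ (i : ℕ) with hR
  have hRcoeff : ∀ k : Fin d, R.coeff k = tauR d b (S, k) := by
    intro k
    rw [hR, finsetSum_coeff]
    simp only [coeff_C_mul_X_pow]
    rw [Finset.sum_eq_single k (fun i _ hik => if_neg fun h => hik (Fin.ext h).symm)
      (fun hk => absurd (Finset.mem_univ k) hk), if_pos rfl]
  have hRdeg : R.natDegree < d := by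
    rcases eq_or_ne R 0 with h0 | h0
    · rw [h0, natDegree_zero]; exact hd0
    · rw [natDegree_lt_iff_degree_lt h0, hR]
      refine lt_of_le_of_lt (degree_sum_le _ _) ?_
      refine (Finset.sup_lt_iff (WithBot.bot_lt_coe d)).mpr fun i _ => ?_
      exact lt_of_le_of_lt (degree_C_mul_X_pow_le _ _) (WithBot.coe_lt_coe.mpr i.2)
  have hR0 : R = 0 := by
    by_contra hR0
    obtain ⟨ζ, hζ, hRζ⟩ := exists_root_eval_ne_zero hsep (natDegree_genF0 d b) hR0 hRdeg
    apply hRζ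
    have hδ : δ0 d b ζ ≠ 0 := by
      unfold δ0 deltaHat
      have h1 := hsep.aeval_derivative_ne_zero (x := ζ) (by rw [Polynomial.coe_aeval_eq_eval]; exact hζ)
      rwa [Polynomial.coe_aeval_eq_eval] at h1
    have hv := minors_vanish_of_mul d hd0 hζ hδ hg hh hgpos hhpos hψ S
    rw [hR, eval_finsetSum]
    simp only [eval_mul, eval_C, eval_pow, eval_X]
    exact hv
  have hk := hRcoeff ι
  rw [hR0, coeff_zero] at hk
  exact hk.symm

/-- If `λ = [x^d y⁰] φ = 0` then `psi d (bT d φ) = x^{d-1} (x + β(y))` splits (`d ≥ 2`). [folklore] -/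
theorem psi_bT_eq_of_lam_zero {T : Type*} [CommRing T] (hd : 2 ≤ d) (φ : Polynomial (Polynomial T))
    (hlam : (φ.coeff d).coeff 0 = 0) :
    psi d (bT d φ) = X * (X ^ (d - 2) *
      (X + C (∑ j : Fin (d + 1), C ((φ.coeff (d - 1)).coeff j) * X ^ (j : ℕ)))) := by
  have hd0 : 0 < d := by omega
  rw [psi_eq, Fintype.sum_prod_type, Finset.sum_eq_single (⟨d - 1, by omega⟩ : Fin d)]
  · simp only [bT, hlam]
    rw [show d - 1 - (d - 1) = 0 from Nat.sub_self _, pow_zero]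
    simp only [mul_one]
    rw [← Finset.sum_mul, ← map_sum]
    obtain ⟨k, rfl⟩ : ∃ k, d = k + 2 := ⟨d - 2, by omega⟩
    rw [show k + 2 - 1 = k + 1 from rfl, show k + 2 - 2 = k from Nat.add_sub_cancel k 2]
    ring
  · intro i _ hi
    have hi' : (i : ℕ) ≠ d - 1 := fun h => hi (Fin.ext h)
    refine Finset.sum_eq_zero fun j _ => ?_
    simp only [bT, hlam]
    rw [zero_pow (by have := i.2; omega), mul_zero, map_zero, zero_mul, map_zero, zero_mul]
  · intro h
    exact absurd (Finset.mem_univ _) h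

/-- If `f` is reducible (and not a unit), `deg f = d` and `λ_p ≠ 0`, then `φ_p` is reducible: the
images of the factors keep positive `x`-degree because `λ = λ_a λ_b`. [cite: Kaltofen1995, Lemma 7 (proof, "⇐")] -/
theorem not_irreducible_aeval_sT {f : MvPolynomial (Fin n) F} (hnirr : ¬ Irreducible f)
    (hfd : f.totalDegree = d) (p : PIdx n → F)
    (hlam : ((MvPolynomial.aeval (sT p) f).coeff d).coeff 0 ≠ 0) :
    ¬ Irreducible (MvPolynomial.aeval (sT p) f) := by
  intro hirr
  have hf0 : f ≠ 0 := by
    rintro rfl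
    exact hlam (by rw [map_zero, coeff_zero, coeff_zero])
  have hfu : ¬ IsUnit f := fun hu => hirr.not_isUnit (hu.map _)
  obtain ⟨a, b, hab, ha, hb⟩ : ∃ a b, f = a * b ∧ ¬ IsUnit a ∧ ¬ IsUnit b := by
    by_contra hcon
    push Not at hcon
    exact hnirr ⟨hfu, fun a b hab => or_iff_not_imp_left.mpr (hcon a b hab)⟩
  have ha0 : a ≠ 0 := by
    rintro rfl
    exact hf0 (by rw [hab, zero_mul])
  have hb0 : b ≠ 0 := by
    rintro rfl
    exact hf0 (by rw [hab, mul_zero])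
  have hdeg : a.totalDegree + b.totalDegree = d := by
    rw [← MvPolynomial.totalDegree_mul_of_isDomain ha0 hb0, ← hab, hfd]
  have hTa : TDeg (MvPolynomial.aeval (sT p) a) a.totalDegree := TDeg_aeval_sT (p := p) a
  have hTb : TDeg (MvPolynomial.aeval (sT p) b) b.totalDegree := TDeg_aeval_sT (p := p) b
  have hφ : MvPolynomial.aeval (sT p) f = MvPolynomial.aeval (sT p) a * MvPolynomial.aeval (sT p) b := by
    rw [hab, map_mul]
  have hlam' : ((MvPolynomial.aeval (sT p) f).coeff d).coeff 0 =
      ((MvPolynomial.aeval (sT p) a).coeff a.totalDegree).coeff 0 *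
        ((MvPolynomial.aeval (sT p) b).coeff b.totalDegree).coeff 0 := by
    rw [hφ, ← hdeg, coeff_mul_add_eq_of_natDegree_le hTa.natDegree_le hTb.natDegree_le, mul_coeff_zero]
  rw [hlam'] at hlam
  -- the images of the factors have positive `x`-degree, hence are not units
  have key : ∀ {c : MvPolynomial (Fin n) F}, c ≠ 0 → ¬ IsUnit c →
      ((MvPolynomial.aeval (sT p) c).coeff c.totalDegree).coeff 0 ≠ 0 →
        ¬ IsUnit (MvPolynomial.aeval (sT p) c) := by
    intro c hc0 hcu hcl hu
    have hpos : 0 < c.totalDegree := by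
      refine Nat.pos_of_ne_zero fun h0 => hcu ?_
      rw [MvPolynomial.totalDegree_eq_zero_iff_eq_C] at h0
      rw [h0]
      refine (Ne.isUnit ?_).map MvPolynomial.C
      intro hc
      exact hc0 (by rw [h0, hc, map_zero])
    have hne : (MvPolynomial.aeval (sT p) c).coeff c.totalDegree ≠ 0 := fun h => hcl (by rw [h, coeff_zero])
    have h1 := le_natDegree_of_ne_zero hne
    have h2 := natDegree_eq_zero_of_isUnit hu
    omega
  rcases hirr.isUnit_or_isUnit hφ with hu | hu
  · exact key ha0 ha (left_ne_zero_of_mul hlam) hu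
  · exact key hb0 hb (right_ne_zero_of_mul hlam) hu

/-- **Pointwise vanishing (⇐)**: if `deg f < d` or `f` is reducible then at every parameter point
`Res_{d,d}(ψ₀, ψ₀') · τ_t = 0`. [cite: Kaltofen1995, Lemma 7 (proof, "⇐": "if `f` is reducible or
`deg f < d` … `Φ_t = 0`")] -/
theorem res_mul_tauR_eq_zero [IsAlgClosed F] {f : MvPolynomial (Fin n) F} (hf : f.totalDegree ≤ d)
    (hd : 2 ≤ d) (H : f.totalDegree < d ∨ ¬ Irreducible f) (p : PIdx n → F) (t : TIdx d) :
    (genF0 d (bT d (MvPolynomial.aeval (sT p) f))).resultant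
        (derivative (genF0 d (bT d (MvPolynomial.aeval (sT p) f)))) d d *
      tauR d (bT d (MvPolynomial.aeval (sT p) f)) t = 0 := by
  have hd0 : 0 < d := by omega
  set φ := MvPolynomial.aeval (sT p) f with hφ
  by_cases hres : (genF0 d (bT d φ)).resultant (derivative (genF0 d (bT d φ))) d d = 0
  · rw [hres, zero_mul]
  refine mul_eq_zero_of_right _ ?_
  have hsep : (genF0 d (bT d φ)).Separable :=
    (resultant_dd_ne_zero_iff_separable (monic_genF0 d _) (natDegree_genF0 d _) hd0).mp hres
  obtain ⟨g, h, hg, hh, hgpos, hhpos, hψ⟩ : ∃ g h : Polynomial (Polynomial F), g.Monic ∧ h.Monic ∧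
      0 < g.natDegree ∧ 0 < h.natDegree ∧ psi d (bT d φ) = g * h := by
    by_cases hlam : (φ.coeff d).coeff 0 = 0
    · have hhm : (X ^ (d - 2) * (X + C (∑ j : Fin (d + 1), C ((φ.coeff (d - 1)).coeff j) * X ^ (j : ℕ))) :
          Polynomial (Polynomial F)).Monic := (monic_X_pow _).mul (monic_X_add_C _)
      refine ⟨_, _, monic_X, hhm, ?_, ?_, psi_bT_eq_of_lam_zero hd φ hlam⟩
      · rw [natDegree_X]; exact one_pos
      · rw [(monic_X_pow _).natDegree_mul (monic_X_add_C _), natDegree_X_pow, natDegree_X_add_C]; omega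
    · have hTφ : TDeg φ f.totalDegree := TDeg_aeval_sT (p := p) f
      have hfd : f.totalDegree = d := by
        by_contra hne
        exact hlam (by rw [hTφ.coeff_eq_zero (lt_of_le_of_ne hf hne), coeff_zero])
      have hnirr : ¬ Irreducible f := H.resolve_left (by omega)
      have hTφd : TDeg φ d := by rw [← hfd]; exact hTφ
      have hpsi : ¬ Irreducible (psi d (bT d φ)) := fun hirr =>
        not_irreducible_aeval_sT hnirr hfd p hlam ((irreducible_psi_bT_iff hd0 hTφd hlam).mp hirr)
      exact exists_monic_split (monic_psi d _) hpsi (by rw [natDegree_psi]; exact hd0)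
  exact tauR_eq_zero_of_split hd0 hsep hg hh hgpos hhpos hψ t

/-- `Λ_q : ℤ[p, c] → F[p]`, `c ↦ q`. [folklore] -/
def Λq (q : CIdx n → F) : 𝔼 n →ₐ[ℤ] MvPolynomial (PIdx n) F :=
  MvPolynomial.aeval (Sum.elim MvPolynomial.X fun e => MvPolynomial.C (q e))

/-- `Λ_q P` evaluated at `p` is `P(p, q)`. [folklore] -/
theorem eval_Λq (q : CIdx n → F) (p : PIdx n → F) (P : 𝔼 n) : MvPolynomial.eval p (Λq q P) = evF p q P := by
  rw [evF_eq_aeval, Λq, MvPolynomial.map_aeval, MvPolynomial.aeval_def, MvPolynomial.coe_eval₂Hom,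
    show (MvPolynomial.eval p).comp (algebraMap ℤ (MvPolynomial (PIdx n) F)) = algebraMap ℤ F from
      RingHom.ext_int _ _,
    show (fun i => MvPolynomial.eval p (Sum.elim MvPolynomial.X (fun e => MvPolynomial.C (q e)) i)) = Sum.elim p q from
      funext fun i => by cases i <;> simp]

/-- If `P(p, q) Q(p, q) = 0` for all `p` then `[p^{m₁}]P (q) · [p^{m₂}]Q (q) = 0`. [folklore] -/
theorem aeval_pcoeff_mul_eq_zero [IsAlgClosed F] (q : CIdx n → F) (P Q : 𝔼 n)
    (h : ∀ p : PIdx n → F, evF p q P * evF p q Q = 0) (m₁ m₂ : PIdx n →₀ ℕ) :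
    MvPolynomial.aeval q (pcoeff m₁ P) * MvPolynomial.aeval q (pcoeff m₂ Q) = 0 := by
  have hΛ : Λq q P * Λq q Q = 0 := by
    rw [← map_mul]
    exact MvPolynomial.funext fun p => by rw [map_zero, map_mul, map_mul, eval_Λq, eval_Λq]; exact h p
  have van : ∀ {R : 𝔼 n} (m : PIdx n →₀ ℕ), Λq q R = 0 → MvPolynomial.aeval q (pcoeff m R) = 0 := by
    intro R m hR
    by_contra hne
    obtain ⟨p, hp⟩ := exists_aeval_sumElim_ne_zero q R hne
    apply hp
    rw [← evF_eq_aeval, ← eval_Λq, hR, map_zero]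
  rcases mul_eq_zero.mp hΛ with h0 | h0
  · rw [van m₁ h0, zero_mul]
  · rw [van m₂ h0, mul_zero]

/-- **(⇐)**: if `deg f < d` or `f` is reducible over the algebraically closed `F` then all forms vanish.
[cite: Kaltofen1995, Thm. 7 & Lemma 7 (proof, "⇐")] -/
theorem forms_vanish_of [IsAlgClosed F] {f : MvPolynomial (Fin n) F} (hf : f.totalDegree ≤ d) (hd : 2 ≤ d)
    (H : f.totalDegree < d ∨ ¬ Irreducible f) (t : KIdx n d) :
    MvPolynomial.aeval (fun e => f.coeff e) (Φform n d t) = 0 := by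
  rw [Φform, map_mul, map_mul, mul_assoc]
  refine mul_eq_zero_of_right _ (aeval_pcoeff_mul_eq_zero _ _ _ (fun p => ?_) _ _)
  rw [evF_Pbar hf (fun _ => rfl), evF_tauR_bgen hf (fun _ => rfl)]
  exact res_mul_tauR_eq_zero hf hd H p _

variable {m : ℕ}

/-- **(⇒)**: if `deg f = d` and `f` is irreducible over the algebraically closed `F` then some form does
not vanish. [cite: Kaltofen1995, Thm. 7 & Lemma 7 (proof, "⇒": "`Φ_t` cannot vanish")] -/
theorem exists_form_ne_zero [IsAlgClosed F] {f : MvPolynomial (Fin (m + 1)) F} (hfirr : Irreducible f)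
    (hfd : f.totalDegree = d) (hd : 2 ≤ d) :
    ∃ t : KIdx (m + 1) d, MvPolynomial.aeval (fun e => f.coeff e) (Φform (m + 1) d t) ≠ 0 := by
  have hd0 : 0 < d := by omega
  have hf : f.totalDegree ≤ d := hfd.le
  -- a non-zero coefficient
  obtain ⟨e, he⟩ := MvPolynomial.ne_zero_iff.mp hfirr.ne_zero
  have heS : e ∈ Sd (m + 1) d := by
    rw [mem_Sd, Finsupp.degree_apply]
    exact (MvPolynomial.le_totalDegree (MvPolynomial.mem_support_iff.mpr he)).trans hf
  -- Lemma 4: a point where the resultant does not vanish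
  obtain ⟨p₁, -, hsep⟩ := exists_point_separable hfirr hfd hd0
  have hres : evF p₁ (fun e => f.coeff e) (Pbar (m + 1) d) ≠ 0 := by
    rw [evF_Pbar hf (fun _ => rfl)]
    exact (resultant_dd_ne_zero_iff_separable (monic_genF0 d _) (natDegree_genF0 d _) hd0).mpr hsep
  obtain ⟨m₁, hm₁⟩ : ∃ m₁, MvPolynomial.aeval (fun e => f.coeff e) (pcoeff m₁ (Pbar (m + 1) d)) ≠ 0 := by
    by_contra hall
    push Not at hall
    exact hres (by rw [evF_eq_aeval]; exact aeval_sumElim_eq_zero p₁ _ _ hall)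
  have hm₁M : m₁ ∈ M₁ (m + 1) d := by
    by_contra hnot
    exact hm₁ (by rw [pcoeff_eq_zero_of_not_mem hnot, map_zero])
  -- Claim B: a point where some `τ`-form does not vanish
  obtain ⟨p₂, t', ht'⟩ := exists_point_tauR_ne_zero hfirr hfd hd
  have hτ : evF p₂ (fun e => f.coeff e) (tauR d (bgen (m + 1) d) t') ≠ 0 := by
    rwa [evF_tauR_bgen hf (fun _ => rfl)]
  obtain ⟨m₂, hm₂⟩ : ∃ m₂, MvPolynomial.aeval (fun e => f.coeff e) (pcoeff m₂ (tauR d (bgen (m + 1) d) t')) ≠ 0 := by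
    by_contra hall
    push Not at hall
    exact hτ (by rw [evF_eq_aeval]; exact aeval_sumElim_eq_zero p₂ _ _ hall)
  have hm₂M : m₂ ∈ M₂ (m + 1) d := by
    have hmem : m₂ ∈ (tauR d (bgen (m + 1) d) t').support.image lpart := by
      by_contra hnot
      exact hm₂ (by rw [pcoeff_eq_zero_of_not_mem hnot, map_zero])
    exact Finset.mem_biUnion.mpr ⟨t', Finset.mem_univ _, hmem⟩
  refine ⟨(⟨e, heS⟩, ⟨m₁, hm₁M⟩, ⟨m₂, hm₂M⟩, t'), ?_⟩
  rw [Φform, map_mul, map_mul, MvPolynomial.aeval_X]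
  exact mul_ne_zero (mul_ne_zero he hm₁) hm₂

omit [Field F] in
/-- The forms commute with coefficient maps. [folklore] -/
theorem aeval_coeff_map {K L : Type*} [CommRing K] [CommRing L] (g : K →+* L) (f : MvPolynomial (Fin n) K)
    (P : MvPolynomial (CIdx n) ℤ) :
    MvPolynomial.aeval (fun e => (MvPolynomial.map g f).coeff e) P =
      g (MvPolynomial.aeval (fun e => f.coeff e) P) := by
  rw [MvPolynomial.map_aeval, MvPolynomial.aeval_def, MvPolynomial.coe_eval₂Hom,
    show g.comp (algebraMap ℤ K) = algebraMap ℤ L from RingHom.ext_int _ _,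
    show (fun e => (MvPolynomial.map g f).coeff e) = fun i => g (f.coeff i) from
      funext fun e => MvPolynomial.coeff_map g f e]

/-- **The equivalence over an algebraically closed field.** [cite: Kaltofen1995, Thm. 7] -/
theorem forms_vanish_iff [IsAlgClosed F] {f : MvPolynomial (Fin (m + 1)) F} (hf : f.totalDegree ≤ d)
    (hd : 2 ≤ d) :
    (∀ t : KIdx (m + 1) d, MvPolynomial.aeval (fun e => f.coeff e) (Φform (m + 1) d t) = 0) ↔
      (f.totalDegree < d ∨ ¬ Irreducible f) := by
  refine ⟨fun hall => ?_, fun H t => forms_vanish_of hf hd H t⟩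
  by_contra H
  push Not at H
  obtain ⟨t, ht⟩ := exists_form_ne_zero H.2 (le_antisymm hf H.1) hd
  exact ht (hall t)

end Logic

end NoetherForms

/-! ### The theorem -/

open NoetherForms in
/-- **Kaltofen 1995, Theorem 7 (effective Noether irreducibility forms)**, discharging the named fact
`kaltofen1995_thm7`. [cite: Kaltofen1995, Thm. 7] -/
theorem kaltofen1995_thm7_holds : kaltofen1995_thm7 := by
  intro n d hn hd
  obtain ⟨m, rfl⟩ : ∃ m, n = m + 1 := ⟨n - 1, by omega⟩
  refine ⟨KIdx (m + 1) d, inferInstance, Φform (m + 1) d,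
    fun t => ⟨totalDegree_Φform_le (m + 1) hd t, l1Norm_Φform_le (m + 1) hd t⟩, ?_⟩
  intro K _ f hf
  have hinj : Function.Injective (algebraMap K (AlgebraicClosure K)) := (algebraMap K (AlgebraicClosure K)).injective
  have htd : (MvPolynomial.map (algebraMap K (AlgebraicClosure K)) f).totalDegree = f.totalDegree := by
    simp only [MvPolynomial.totalDegree, MvPolynomial.support_map_of_injective _ hinj]
  have hiff := forms_vanish_iff (f := MvPolynomial.map (algebraMap K (AlgebraicClosure K)) f) (d := d)
    (by rw [htd]; exact hf) hd
  rw [htd] at hiff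
  refine Iff.trans ?_ hiff
  refine forall_congr' fun t => ?_
  rw [aeval_coeff_map, map_eq_zero_iff _ hinj]

end Literature.RingTheory.MvPolynomial
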